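import Mathlib.Topology.Algebra.Module.FiniteDimension
import Mathlib.Analysis.Normed.Module.FiniteDimension
import Literature.MathematicalPhysics.QuantumFieldTheory.Dimock2011to13.QED3FermionNorm
import Literature.MathematicalPhysics.QuantumFieldTheory.Dimock2011to13.QED3MultiweightNorm
import Literature.MathematicalPhysics.QuantumFieldTheory.Dimock2011to13.QED3SmallFieldFermionRatio
import HarnessLib

/-!
# Dimock, *Ultraviolet stability for QED in d = 3*, App. B «Norms» (536) — the MULTISCALE norm `‖E‖_𝐡`, `𝐡 = (h_1,…,h_k)`
# («These can also be combined for mixed versions»), in the tree as the weight-per-generator norm `QED3TorusI.hNormW w`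
# with its product inequality — PACKAGED like the single-scale `QED3GrassmannNormedAlgebra`: the Grassmann algebra with
# `‖·‖_w` (all weights `w(ξ) > 0`) IS a complete normed algebra with `‖1‖ = 1`, and D8 (511)–(514) hold on it

statement-level skeleton of published theorems with citation tags; proofs where landed; nothing here is a claim about the Yang–Mills mass gap

**Citation header (reproduction of PUBLISHED work).** J. Dimock, *Ultraviolet stability for QED in d = 3*, Ann. Henri
Poincaré **23** (2022) 2113–2205 (= arXiv:2009.01156v2) [Dimock2022UVStabilityQED3], App. B «Norms» (528)–(536) p.73 L25 –
p.74 L65 (single scale (529)∕(531), pair (533), multiscale (536) «a multiweight `h = (h_1,…,h_k)`»), in the tree as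
`QED3MultiweightNorm` (`hNormW`, `hNormW_mul_le`, `hNormW_one`, `hNormW_smul`, `hNormW_add_le`, `hNormW_const`); the norms
are USED as Banach-algebra norms in §4.2 (LEMMAS 19–21 with the multiweights `I_K`, `L·I_K`; LEMMA 26 (511)–(514) p.69
L112 – p.70 L33 with `‖·‖₁`); J. Dimock, *Quantum electrodynamics on the 3-torus. I*, arXiv:math-ph/0210020
[Dimock2002QED3TorusI], App. B (299) + LEMMA 19 p.62 L9–24 (the one-weight case).  Writer seat p11
(literature-prover-lit-balaban-p11-g25-0), YM LIT SWEEP item (c) D8 (row C08; zero weight for the YM-INPRINT tokens).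

**The printed text (verbatim, text layer of D8).** p.74 L57–65: *"… a multiweight `h = (h_1,…,h_k)` … `‖E‖_h = Σ
h_1^{n_1}⋯h_k^{n_k}∕(n_1!⋯n_k!) ‖E_{n_1…n_k}‖`"* (536); p.73 L27–28: *"We define some norms on such elements. These can
also be combined for mixed versions."*

**What is formalized (kernel-checked, zero `sorry`, no named facts; definition lane: a type synonym + instances).**
* `HGrassmannW 𝕜 ι w` — the tree's `GrassmannAlgebra 𝕜 ι` REGARDED AS NORMED BY `‖·‖_w = Σ_S (Π_{ξ∈S}w(ξ))|c_S(·)|`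
  (`QED3TorusI.hNormW w`; `w(ξ) = h_{j(ξ)}` gives (536), a constant `w` gives (529) = `QED3GrassmannNormedAlgebra`).
* For positive weights (`[Fact (∀ ξ, 0 < w ξ)]`): `instNormedAddCommGroup` (definiteness `eq_zero_of_hNormW_eq_zero`,
  `hNormW_neg`, `hNormW_zero`), **`instNormedRing`** (`‖FG‖_w ≤ ‖F‖_w‖G‖_w` = the tree's `hNormW_mul_le`),
  `instNormOneClass`, `instNormedSpace`∕**`instNormedAlgebra`** over `𝕜`, `instAlgebraRat`, `instFiniteDimensional`,
  **`instCompleteSpace`**; `norm_def`, `norm_gen` (`‖Ψ(ξ)‖_w = w(ξ)`), `norm_grassmannBasis` (`= Π_{ξ∈S}w(ξ)`),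
  `norm_eq_hNorm_of_const` (constant weight = the single-scale norm).
* `exp_eq_grassmannExp` (on nilpotents `NormedSpace.exp = QuantumLattice.grassmannExp`), `algebraReal`∕`normedAlgebraReal`
  (real scalars, reducible defs, no instance diamond), and **`norm_functional_exp_sub_one_le_grassmannW`** = D8
  (511)–(514) on `(𝒢, ‖·‖_w)` for any additive functional with `|μF| ≤ ‖F‖_w`, `μ1 = 1`.

**Readings (declared).**  As in `QED3GrassmannNormedAlgebra`: a packaging device over the tree's `hNormW`; (536)'s
`1∕(n_1!⋯n_k!)` kernel presentation vs the monomial-basis sum is the identification made in `QED3MultiweightNorm`.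

**Honest scope.**  Instances and one corollary; no new estimate; no Gaussian-integral bound with general weights is
claimed (the tree's LEMMA 21 bound `norm_gaussExpect_le_hNorm` is single-weight).  No `d = 4` statement; nothing about
Bałaban's papers.
-/

noncomputable section

namespace Literature.MathematicalPhysics.QuantumFieldTheory.Dimock2011to13

open Literature.MathematicalPhysics.QuantumLattice
open Literature.MathematicalPhysics.QuantumLattice.GrassmannAlgebra
open QED3TorusI

/-- **The Grassmann algebra normed by the multiweight norm `‖·‖_w`**: a type synonym of the tree's `GrassmannAlgebra 𝕜 ι`
on which (536) `‖F‖_w = Σ_S (Π_{ξ∈S}w(ξ))|c_S(F)|` (`QED3TorusI.hNormW w`) is registered as THE norm.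
[cite: Dimock2022UVStabilityQED3, App. B (536) p.74 L57–65; (529) p.73 L46–52] -/
@[nolint unusedArguments]
def HGrassmannW (𝕜 : Type*) [RCLike 𝕜] (ι : Type*) [LinearOrder ι] [Fintype ι] (_w : ι → ℝ) : Type _ :=
  GrassmannAlgebra 𝕜 ι

namespace HGrassmannW

variable {𝕜 : Type*} [RCLike 𝕜] {ι : Type*} [LinearOrder ι] [Fintype ι] {w : ι → ℝ}

/-- the same ring as the Grassmann algebra. [cite: Dimock2022UVStabilityQED3, App. B (528) p.73 L35–45] -/
instance instRing : Ring (HGrassmannW 𝕜 ι w) := inferInstanceAs (Ring (GrassmannAlgebra 𝕜 ι))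

/-- the same `𝕜`-algebra as the Grassmann algebra. [cite: Dimock2022UVStabilityQED3, App. B (528) p.73 L35–45] -/
instance instAlgebra : Algebra 𝕜 (HGrassmannW 𝕜 ι w) := inferInstanceAs (Algebra 𝕜 (GrassmannAlgebra 𝕜 ι))

/-- the same `ℚ`-algebra as the Grassmann algebra (one structure for `QuantumLattice.grassmannExp` and `NormedSpace.exp`).
[cite: Dimock2022UVStabilityQED3, App. B (528) p.73 L35–45] -/
instance instAlgebraRat : Algebra ℚ (HGrassmannW 𝕜 ι w) := inferInstanceAs (Algebra ℚ (GrassmannAlgebra 𝕜 ι))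

/-- The identity map to the underlying Grassmann algebra. [cite: Dimock2022UVStabilityQED3, App. B (528) p.73 L35–45] -/
def toGrassmann (F : HGrassmannW 𝕜 ι w) : GrassmannAlgebra 𝕜 ι := F

/-- … and back. [cite: Dimock2022UVStabilityQED3, App. B (528) p.73 L35–45] -/
def ofGrassmann (F : GrassmannAlgebra 𝕜 ι) : HGrassmannW 𝕜 ι w := F

/-! ## (536) is a norm: the elementary facts about `hNormW` not in `QED3MultiweightNorm` -/

/-- `‖−F‖_w = ‖F‖_w`. [cite: Dimock2022UVStabilityQED3, App. B (536) p.74 L57–65] -/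
theorem hNormW_neg (w : ι → ℝ) (F : GrassmannAlgebra 𝕜 ι) : hNormW w (-F) = hNormW w F := by
  have e := hNormW_smul w (-1 : 𝕜) F
  rwa [neg_one_smul, norm_neg, norm_one, one_mul] at e

/-- `‖0‖_w = 0`. [cite: Dimock2022UVStabilityQED3, App. B (536) p.74 L57–65] -/
theorem hNormW_zero (w : ι → ℝ) : hNormW w (0 : GrassmannAlgebra 𝕜 ι) = 0 := by
  simp [hNormW, coeff]

/-- **definiteness** (all `w(ξ) > 0`): `‖F‖_w = 0 ⟹ F = 0`. [cite: Dimock2022UVStabilityQED3, App. B (528), (536) p.73 L35–45, p.74 L57–65] -/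
theorem eq_zero_of_hNormW_eq_zero {w : ι → ℝ} (hw : ∀ ξ, 0 < w ξ) {F : GrassmannAlgebra 𝕜 ι} (hF : hNormW w F = 0) :
    F = 0 := by
  have hpos : ∀ S : Finset ι, 0 < monoWeight w S := fun S => Finset.prod_pos fun ξ _ => hw ξ
  have hterm : ∀ S ∈ (Finset.univ : Finset (Finset ι)), monoWeight w S * ‖coeff F S‖ = 0 :=
    (Finset.sum_eq_zero_iff_of_nonneg fun S _ => mul_nonneg (hpos S).le (norm_nonneg _)).mp hF
  apply (grassmannBasis 𝕜 ι).repr.injective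
  ext S
  have hS := hterm S (Finset.mem_univ S)
  rw [mul_eq_zero] at hS
  rcases hS with h1 | h1
  · exact absurd h1 (hpos S).ne'
  · simpa [coeff] using h1

/-! ## The instances: `(𝒢, ‖·‖_w)` is a complete normed algebra with `‖1‖ = 1` -/

variable [Fact (∀ ξ, 0 < w ξ)]

omit [LinearOrder ι] [Fintype ι] in
/-- the weights are non-negative. [cite: Dimock2022UVStabilityQED3, App. B (536) p.74 L57–65] -/
theorem w_nonneg (ξ : ι) : 0 ≤ w ξ := ((Fact.out : ∀ ξ, 0 < w ξ) ξ).le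

/-- (536) as an `AddGroupNorm` on the synonym. [cite: Dimock2022UVStabilityQED3, App. B (536) p.74 L57–65] -/
def wAddGroupNorm : AddGroupNorm (HGrassmannW 𝕜 ι w) where
  toFun F := hNormW w (toGrassmann F)
  map_zero' := hNormW_zero w
  add_le' F G := hNormW_add_le (w_nonneg (w := w)) (toGrassmann F) (toGrassmann G)
  neg' F := hNormW_neg w (toGrassmann F)
  eq_zero_of_map_eq_zero' _ hF := eq_zero_of_hNormW_eq_zero (Fact.out : ∀ ξ, 0 < w ξ) hF

/-- `(𝒢, ‖·‖_w)` as a normed additive group. [cite: Dimock2022UVStabilityQED3, App. B (536) p.74 L57–65] -/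
instance instNormedAddCommGroup : NormedAddCommGroup (HGrassmannW 𝕜 ι w) :=
  (wAddGroupNorm (𝕜 := 𝕜) (ι := ι) (w := w)).toNormedAddCommGroup

/-- Unfolding: the norm of the synonym IS `‖·‖_w`. [cite: Dimock2022UVStabilityQED3, App. B (536) p.74 L57–65] -/
theorem norm_def (F : HGrassmannW 𝕜 ι w) : ‖F‖ = hNormW w (toGrassmann F) := rfl

/-- **`(𝒢, ‖·‖_w)` is a normed ring** (`‖FG‖ ≤ ‖F‖‖G‖` = the tree's `hNormW_mul_le`, the multiweight transport of
paper I LEMMA 19). [cite: Dimock2022UVStabilityQED3, App. B (536) p.74 L57–65; Dimock2002QED3TorusI, App. B Lemma 19 p.62 L14–24] -/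
instance instNormedRing : NormedRing (HGrassmannW 𝕜 ι w) :=
  { instNormedAddCommGroup, (inferInstance : Ring (HGrassmannW 𝕜 ι w)) with
    dist_eq := fun _ _ => rfl
    norm_mul_le := fun F G => hNormW_mul_le (w_nonneg (w := w)) (toGrassmann F) (toGrassmann G) }

/-- `‖1‖_w = 1`. [cite: Dimock2022UVStabilityQED3, App. B (536) p.74 L57–65] -/
instance instNormOneClass : NormOneClass (HGrassmannW 𝕜 ι w) := ⟨hNormW_one w⟩

/-- `‖cF‖_w ≤ |c|‖F‖_w` (in fact `=`). [cite: Dimock2022UVStabilityQED3, App. B (536) p.74 L57–65] -/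
instance instNormedSpace : NormedSpace 𝕜 (HGrassmannW 𝕜 ι w) where
  norm_smul_le c F := (hNormW_smul w c (toGrassmann F)).le

/-- `(𝒢, ‖·‖_w)` is a normed `𝕜`-algebra. [cite: Dimock2022UVStabilityQED3, App. B (536) p.74 L57–65] -/
instance instNormedAlgebra : NormedAlgebra 𝕜 (HGrassmannW 𝕜 ι w) where
  norm_smul_le c F := (hNormW_smul w c (toGrassmann F)).le

/-- finitely many generators ⟹ finite-dimensional. [cite: Dimock2022UVStabilityQED3, App. B (528) p.73 L35–45] -/
instance instFiniteDimensional : FiniteDimensional 𝕜 (HGrassmannW 𝕜 ι w) :=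
  Module.Finite.of_basis (grassmannBasis 𝕜 ι)

/-- … hence COMPLETE: `(𝒢, ‖·‖_w)` is a Banach algebra. [cite: Dimock2022UVStabilityQED3, App. B (536) p.74 L57–65] -/
instance instCompleteSpace : CompleteSpace (HGrassmannW 𝕜 ι w) := FiniteDimensional.complete 𝕜 (HGrassmannW 𝕜 ι w)

/-- a generator has norm `w(ξ)`: `‖Ψ(ξ)‖_w = w(ξ)` (`= h_j` for a scale-`j` field in (536)).
[cite: Dimock2022UVStabilityQED3, App. B (536) p.74 L57–65] -/
theorem norm_gen (ξ : ι) : ‖(ofGrassmann (gen 𝕜 ξ) : HGrassmannW 𝕜 ι w)‖ = w ξ := hNormW_gen w ξ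

/-- a monomial has norm `Π_{ξ∈S}w(ξ)` (`= h_1^{n_1}⋯h_k^{n_k}` in (536)). [cite: Dimock2022UVStabilityQED3, App. B (536) p.74 L57–65] -/
theorem norm_grassmannBasis (S : Finset ι) :
    ‖(ofGrassmann (grassmannBasis 𝕜 ι S) : HGrassmannW 𝕜 ι w)‖ = monoWeight w S :=
  hNormW_grassmannBasis w S

omit [Fact (∀ ξ, 0 < w ξ)] in
/-- a constant multiweight is the single-scale norm (529): `‖F‖_{(h,…,h)} = ‖F‖_h`.
[cite: Dimock2022UVStabilityQED3, App. B (529) p.73 L46–52, (536) p.74 L57–65] -/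
theorem norm_eq_hNorm_of_const {h : ℝ} [Fact (∀ _ξ : ι, 0 < h)] (F : HGrassmannW 𝕜 ι (fun _ : ι => h)) :
    ‖F‖ = hNorm h (toGrassmann F) :=
  hNormW_const h (toGrassmann F)

/-- **one exponential, two APIs**: if `E^k = 0` then `NormedSpace.exp E` in `(𝒢, ‖·‖_w)` equals the tree's algebraic
`QuantumLattice.grassmannExp E`. [cite: Dimock2022UVStabilityQED3, §4.2.3 Lemma 26 proof (505)–(506), (511) p.69 L15–22, L112–137] -/
theorem exp_eq_grassmannExp {E : HGrassmannW 𝕜 ι w} {k : ℕ} (hk : E ^ k = 0) :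
    toGrassmann (NormedSpace.exp E) = grassmannExp (toGrassmann E) := by
  have h1 : NormedSpace.exp E = IsNilpotent.exp E := by
    rw [IsNilpotent.exp_eq_sum hk, congrFun NormedSpace.exp_eq_tsum_rat E]
    refine tsum_eq_sum fun n hn => ?_
    rw [Finset.mem_range, not_lt] at hn
    rw [pow_eq_zero_of_le hn hk, smul_zero]
  rw [h1]
  rfl

/-! ## Real scalars (reducible `def`s, not instances) -/

/-- Real scalars acting through `ℝ → 𝕜` (reducible `def`, NOT an instance — no instance diamond on the synonym).
[cite: Dimock2022UVStabilityQED3, App. B (536) p.74 L57–65] -/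
@[reducible] def algebraReal : Algebra ℝ (HGrassmannW 𝕜 ι w) :=
  ((algebraMap 𝕜 (HGrassmannW 𝕜 ι w)).comp (algebraMap ℝ 𝕜)).toAlgebra' fun c x =>
    Algebra.commutes (algebraMap ℝ 𝕜 c) x

/-- The real normed-algebra structure `‖r • F‖_w ≤ |r|‖F‖_w` (reducible `def`).
[cite: Dimock2022UVStabilityQED3, App. B (536) p.74 L57–65] -/
@[reducible] def normedAlgebraReal : NormedAlgebra ℝ (HGrassmannW 𝕜 ι w) :=
  letI : Algebra ℝ (HGrassmannW 𝕜 ι w) := algebraReal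
  { (algebraReal : Algebra ℝ (HGrassmannW 𝕜 ι w)) with
    norm_smul_le := fun r F => by
      change ‖algebraMap 𝕜 (HGrassmannW 𝕜 ι w) (algebraMap ℝ 𝕜 r) * F‖ ≤ ‖r‖ * ‖F‖
      rw [← Algebra.smul_def, norm_def, norm_def]
      change hNormW w ((algebraMap ℝ 𝕜 r) • toGrassmann F) ≤ ‖r‖ * hNormW w (toGrassmann F)
      rw [hNormW_smul]
      simp }

/-! ## D8 (511)–(514) ON `(𝒢, ‖·‖_w)` -/

/-- **(511)–(514) on `(𝒢, ‖·‖_w)`**: for any additive functional `μ` with `|μ F| ≤ ‖F‖_w` and `μ 1 = 1`,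
`|μ(e^E) − 1| ≤ ‖E‖_w e^{‖E‖_w}` (the abstract `QED3SmallFieldFermion.norm_functional_exp_sub_one_le`).
[cite: Dimock2022UVStabilityQED3, §4.2.3 Lemma 26 proof (511)–(514) p.69 L112 – p.70 L33; p.61 L57] -/
theorem norm_functional_exp_sub_one_le_grassmannW (μ : HGrassmannW 𝕜 ι w →+ 𝕜)
    (hμ : ∀ F, ‖μ F‖ ≤ ‖F‖) (hμ1 : μ 1 = 1) (E : HGrassmannW 𝕜 ι w) :
    ‖μ (NormedSpace.exp E) - 1‖ ≤ ‖E‖ * Real.exp ‖E‖ := by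
  letI : NormedAlgebra ℝ (HGrassmannW 𝕜 ι w) := normedAlgebraReal
  exact QED3SmallFieldFermion.norm_functional_exp_sub_one_le μ hμ hμ1 E

end HGrassmannW

end Literature.MathematicalPhysics.QuantumFieldTheory.Dimock2011to13
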